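import Summits.RiemannHypothesis.RiemannHypothesis.Theorems.TiltedLandingLaw421SuccessorCertificateFrozen

/-!
# Successor Certificate §2-§3: Uniqueness and Linearised Successor Law

W-07 · route `EarlyAppointments` · crux `TiltedLandingLaw421` (stmt-RiemannHypothesis-24774).
Support module from C3 g22/g23 (a8b429b0). Part 2 of 2: uniqueness and the linearised-field successor law.

CONTENT (all K, 0 sorry):
- §2 uniqueness: `successor_unique_of_netField`, `successor_existsUnique_of_netField`,
  `netField_lipschitz_of_deriv_bound`, `successor_existsUnique_of_derivBound`;
- §3 `successor_of_linearisedField` — the SECOND-ORDER law, `LinearisedGAt` + `linearisedGAt_exit`.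

[cite: rh-idea-3 g23 SuccessorCertificate-W07c12]
-/

open Set Complex Metric Filter Topology

noncomputable section

namespace RhW07.Law421.SuccessorCertificate

/-! ## §2 UNIQUENESS of the certified successor -/

/-- ★ (K) **UNIQUENESS of the successor in the certified disc.** -/
theorem successor_unique_of_netField {g h : ℂ → ℂ} {a ε Θ ρ Λ : ℝ} {c : ℂ} (hPF : PairFactor g h a ε) (hc : c ≠ 0)
    (hΛ : (1 / ‖c‖ + ρ) * Λ < ‖c‖ - Θ)
    (hB : ∀ z ∈ Metric.closedBall ((a : ℂ) + (ε : ℂ) * I - 1 / c) ρ,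
      h z ≠ 0 ∧ z ≠ (a : ℂ) - (ε : ℂ) * I ∧ ‖(z - ((a : ℂ) - (ε : ℂ) * I))⁻¹ + deriv h z / h z - c‖ ≤ Θ)
    (hLip : ∀ z ∈ Metric.closedBall ((a : ℂ) + (ε : ℂ) * I - 1 / c) ρ,
      ∀ w ∈ Metric.closedBall ((a : ℂ) + (ε : ℂ) * I - 1 / c) ρ,
      ‖((z - ((a : ℂ) - (ε : ℂ) * I))⁻¹ + deriv h z / h z) - ((w - ((a : ℂ) - (ε : ℂ) * I))⁻¹ + deriv h w / h w)‖
        ≤ Λ * ‖z - w‖) :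
    ∀ z₁ ∈ Metric.closedBall ((a : ℂ) + (ε : ℂ) * I - 1 / c) ρ,
      ∀ z₂ ∈ Metric.closedBall ((a : ℂ) + (ε : ℂ) * I - 1 / c) ρ, deriv g z₁ = 0 → deriv g z₂ = 0 → z₁ = z₂ := by
  intro z₁ hz₁ z₂ hz₂ hg₁ hg₂
  set u : ℂ := (a : ℂ) + (ε : ℂ) * I with hu
  set v : ℂ := (a : ℂ) - (ε : ℂ) * I with hv
  set b : ℂ → ℂ := fun z => (z - v)⁻¹ + deriv h z / h z with hb
  obtain ⟨hh₁, hv₁, hΘ₁⟩ := hB z₁ hz₁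
  obtain ⟨hh₂, hv₂, hΘ₂⟩ := hB z₂ hz₂
  -- G zᵢ = 0
  have hG : ∀ z, z ∈ Metric.closedBall (u - 1 / c) ρ → deriv g z = 0 → 1 + (z - u) * b z = 0 := by
    intro z hz hgz
    obtain ⟨hhz, hvz, -⟩ := hB z hz
    have e := deriv_pair_eq_G hPF hhz hvz
    rw [hgz] at e
    have hne : (z - v) * h z ≠ 0 := mul_ne_zero (sub_ne_zero.mpr hvz) hhz
    have : (z - v) * h z * (1 + (z - u) * b z) = 0 := by rw [hb]; exact e.symm
    rcases mul_eq_zero.mp this with h0 | h0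
    · exact absurd h0 hne
    · exact h0
  have e₁ := hG z₁ hz₁ hg₁
  have e₂ := hG z₂ hz₂ hg₂
  -- the algebraic identity
  have key : (z₁ - z₂) * b z₂ = -((z₁ - u) * (b z₁ - b z₂)) := by linear_combination e₁ - e₂
  by_contra hne
  have hd : 0 < ‖z₁ - z₂‖ := norm_pos_iff.mpr (sub_ne_zero.mpr hne)
  have hcpos : 0 < ‖c‖ := norm_pos_iff.mpr hc
  -- lower bound on ‖b z₂‖
  have hb₂ : ‖c‖ - Θ ≤ ‖b z₂‖ := by
    have : ‖c‖ - ‖b z₂ - c‖ ≤ ‖b z₂‖ := by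
      have := norm_sub_norm_le c (c - b z₂)
      simp only [sub_sub_cancel] at this
      rw [norm_sub_rev] at this
      linarith [norm_sub_rev (b z₂) c]
    have hΘ₂' : ‖b z₂ - c‖ ≤ Θ := by simpa [hb] using hΘ₂
    linarith
  -- upper bound on ‖z₁ - u‖
  have hz₁u : ‖z₁ - u‖ ≤ 1 / ‖c‖ + ρ := by
    have h1 : ‖z₁ - (u - 1 / c)‖ ≤ ρ := mem_closedBall_iff_norm.mp hz₁
    have h2 : ‖(u - 1 / c) - u‖ = 1 / ‖c‖ := by
      rw [show (u - 1 / c) - u = -(1 / c) by ring, norm_neg, norm_div, norm_one]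
    calc ‖z₁ - u‖ = ‖(z₁ - (u - 1 / c)) + ((u - 1 / c) - u)‖ := by ring_nf
      _ ≤ ‖z₁ - (u - 1 / c)‖ + ‖(u - 1 / c) - u‖ := norm_add_le _ _
      _ ≤ ρ + 1 / ‖c‖ := by rw [h2]; linarith
      _ = 1 / ‖c‖ + ρ := by ring
  have hLip₁₂ : ‖b z₁ - b z₂‖ ≤ Λ * ‖z₁ - z₂‖ := by simpa [hb] using hLip z₁ hz₁ z₂ hz₂
  have hΛnn : 0 ≤ Λ * ‖z₁ - z₂‖ := le_trans (norm_nonneg _) hLip₁₂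
  -- compare norms of the two sides of `key`
  have lhs : ‖z₁ - z₂‖ * (‖c‖ - Θ) ≤ ‖(z₁ - z₂) * b z₂‖ := by
    rw [norm_mul]; exact mul_le_mul_of_nonneg_left hb₂ (norm_nonneg _)
  have rhs : ‖(z₁ - z₂) * b z₂‖ ≤ (1 / ‖c‖ + ρ) * (Λ * ‖z₁ - z₂‖) := by
    rw [key, norm_neg, norm_mul]
    exact mul_le_mul hz₁u hLip₁₂ (norm_nonneg _) ((norm_nonneg _).trans hz₁u)
  have : ‖z₁ - z₂‖ * (‖c‖ - Θ) ≤ ‖z₁ - z₂‖ * ((1 / ‖c‖ + ρ) * Λ) := by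
    calc ‖z₁ - z₂‖ * (‖c‖ - Θ) ≤ (1 / ‖c‖ + ρ) * (Λ * ‖z₁ - z₂‖) := lhs.trans rhs
      _ = ‖z₁ - z₂‖ * ((1 / ‖c‖ + ρ) * Λ) := by ring
  have := lt_of_mul_lt_mul_left (lt_of_le_of_lt this (mul_lt_mul_of_pos_left hΛ hd)) hd.le
  exact lt_irrefl _ this

/-- ★ (K) existence AND uniqueness packaged: under both certificates there is EXACTLY ONE zero of `g′` in `D̄(u − 1/c, ρ)`. -/
theorem successor_existsUnique_of_netField {g h : ℂ → ℂ} {a ε Θ ρ Λ : ℝ} {c : ℂ} (hPF : PairFactor g h a ε)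
    (hc : c ≠ 0) (hρ : 0 < ρ) (hnum : 4 * Θ < ρ * ‖c‖ * (‖c‖ - Θ)) (hΛ : (1 / ‖c‖ + ρ) * Λ < ‖c‖ - Θ)
    (hB : ∀ z ∈ Metric.closedBall ((a : ℂ) + (ε : ℂ) * I - 1 / c) ρ,
      h z ≠ 0 ∧ z ≠ (a : ℂ) - (ε : ℂ) * I ∧ ‖(z - ((a : ℂ) - (ε : ℂ) * I))⁻¹ + deriv h z / h z - c‖ ≤ Θ)
    (hLip : ∀ z ∈ Metric.closedBall ((a : ℂ) + (ε : ℂ) * I - 1 / c) ρ,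
      ∀ w ∈ Metric.closedBall ((a : ℂ) + (ε : ℂ) * I - 1 / c) ρ,
      ‖((z - ((a : ℂ) - (ε : ℂ) * I))⁻¹ + deriv h z / h z) - ((w - ((a : ℂ) - (ε : ℂ) * I))⁻¹ + deriv h w / h w)‖
        ≤ Λ * ‖z - w‖) :
    ∃! z₁, z₁ ∈ Metric.closedBall ((a : ℂ) + (ε : ℂ) * I - 1 / c) ρ ∧ deriv g z₁ = 0 := by
  obtain ⟨z₁, hz₁, hg₁⟩ := successor_of_netField hPF hc hρ hnum hB
  exact ⟨z₁, ⟨hz₁, hg₁⟩, fun z₂ ⟨hz₂, hg₂⟩ =>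
    (successor_unique_of_netField hPF hc hΛ hB hLip z₁ hz₁ z₂ hz₂ hg₁ hg₂).symm⟩

/-- ★ (K) the Lipschitz clause from a DERIVATIVE BOUND (`Convex.norm_image_sub_le_of_norm_deriv_le`): if `‖b′‖ ≤ Λ` on `D̄(u − 1/c, ρ)` (where
`h ≠ 0`, `z ≠ ū`, so `b = (z − ū)⁻¹ + h′/h` is differentiable), then `b` is `Λ`-Lipschitz there — the certifier's form of §P‴. -/
theorem netField_lipschitz_of_deriv_bound {h : ℂ → ℂ} (hh : Differentiable ℂ h) {a ε ρ Λ : ℝ} {c : ℂ}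
    (hB : ∀ z ∈ Metric.closedBall ((a : ℂ) + (ε : ℂ) * I - 1 / c) ρ, h z ≠ 0 ∧ z ≠ (a : ℂ) - (ε : ℂ) * I)
    (hD : ∀ z ∈ Metric.closedBall ((a : ℂ) + (ε : ℂ) * I - 1 / c) ρ,
      ‖deriv (fun w : ℂ => (w - ((a : ℂ) - (ε : ℂ) * I))⁻¹ + deriv h w / h w) z‖ ≤ Λ) :
    ∀ z ∈ Metric.closedBall ((a : ℂ) + (ε : ℂ) * I - 1 / c) ρ,
      ∀ w ∈ Metric.closedBall ((a : ℂ) + (ε : ℂ) * I - 1 / c) ρ,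
      ‖((z - ((a : ℂ) - (ε : ℂ) * I))⁻¹ + deriv h z / h z) - ((w - ((a : ℂ) - (ε : ℂ) * I))⁻¹ + deriv h w / h w)‖
        ≤ Λ * ‖z - w‖ := by
  intro z hz w hw
  have hdh : Differentiable ℂ (deriv h) := by
    have := Literature.Analysis.Complex.differentiable_iteratedDeriv_of_entire hh 1
    simpa [iteratedDeriv_one] using this
  have hdiff : ∀ x ∈ Metric.closedBall ((a : ℂ) + (ε : ℂ) * I - 1 / c) ρ,
      DifferentiableAt ℂ (fun w : ℂ => (w - ((a : ℂ) - (ε : ℂ) * I))⁻¹ + deriv h w / h w) x := by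
    intro x hx
    obtain ⟨hhx, hvx⟩ := hB x hx
    refine DifferentiableAt.add ?_ ?_
    · exact ((differentiableAt_fun_id.sub (differentiableAt_const _)).inv (sub_ne_zero.mpr hvx))
    · exact (hdh x).div (hh x) hhx
  have := (convex_closedBall ((a : ℂ) + (ε : ℂ) * I - 1 / c) ρ).norm_image_sub_le_of_norm_deriv_le hdiff hD hw hz
  simpa using this

/-- ★ (K) `∃!` successor from the two SUP-NORM certificates a certifier actually computes: `‖b − c‖ ≤ Θ` and `‖b′‖ ≤ Λ` on `D̄(u − 1/c, ρ)` with
`4Θ < ρ‖c‖(‖c‖ − Θ)` and `(1/‖c‖ + ρ)·Λ < ‖c‖ − Θ`. -/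
theorem successor_existsUnique_of_derivBound {g h : ℂ → ℂ} {a ε Θ ρ Λ : ℝ} {c : ℂ} (hPF : PairFactor g h a ε)
    (hc : c ≠ 0) (hρ : 0 < ρ) (hnum : 4 * Θ < ρ * ‖c‖ * (‖c‖ - Θ)) (hΛ : (1 / ‖c‖ + ρ) * Λ < ‖c‖ - Θ)
    (hB : ∀ z ∈ Metric.closedBall ((a : ℂ) + (ε : ℂ) * I - 1 / c) ρ,
      h z ≠ 0 ∧ z ≠ (a : ℂ) - (ε : ℂ) * I ∧ ‖(z - ((a : ℂ) - (ε : ℂ) * I))⁻¹ + deriv h z / h z - c‖ ≤ Θ)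
    (hD : ∀ z ∈ Metric.closedBall ((a : ℂ) + (ε : ℂ) * I - 1 / c) ρ,
      ‖deriv (fun w : ℂ => (w - ((a : ℂ) - (ε : ℂ) * I))⁻¹ + deriv h w / h w) z‖ ≤ Λ) :
    ∃! z₁, z₁ ∈ Metric.closedBall ((a : ℂ) + (ε : ℂ) * I - 1 / c) ρ ∧ deriv g z₁ = 0 :=
  successor_existsUnique_of_netField hPF hc hρ hnum hΛ hB
    (netField_lipschitz_of_deriv_bound hPF.1 (fun z hz => ⟨(hB z hz).1, (hB z hz).2.1⟩) hD)

/-! ## §3 THE SECOND-ORDER (LINEARISED-FIELD) SUCCESSOR LAW -/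

/-- ★★ **THE LINEARISED-FIELD SUCCESSOR LAW (K).**  `PairFactor g h a ε` (`u = a + iε`, `ū = a − iε`), field data `c c' : ℂ`, a root `z₀` of the
linearised comparison map `1 + (z₀ − u)(c + c'(z₀ − u)) = 0`, `κ := c + 2c'(z₀ − u)`; on `D̄(z₀, ρ)`: `h ≠ 0`, `z ≠ ū` and the NET field
`b = (z − ū)⁻¹ + h′/h` satisfies `‖b z − (c + c'(z − u))‖ ≤ Θ₂`; numerics `(4‖z₀ − u‖ + ρ)·Θ₂ < ρ(‖κ‖ − ‖c'‖ρ)`.  Then `g′` has a zero in `D̄(z₀, ρ)`.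
(`c' = 0`, `z₀ = u − 1/c`, `κ = c`: the frozen law with condition `(4/‖c‖ + ρ)Θ < ρ‖c‖`.) -/
theorem successor_of_linearisedField {g h : ℂ → ℂ} {a ε Θ₂ ρ : ℝ} {c c' z₀ : ℂ} (hPF : PairFactor g h a ε)
    (hρ : 0 < ρ)
    (hz0 : 1 + (z₀ - ((a : ℂ) + (ε : ℂ) * I)) * (c + c' * (z₀ - ((a : ℂ) + (ε : ℂ) * I))) = 0)
    (hnum : (4 * ‖z₀ - ((a : ℂ) + (ε : ℂ) * I)‖ + ρ) * Θ₂
      < ρ * (‖c + 2 * c' * (z₀ - ((a : ℂ) + (ε : ℂ) * I))‖ - ‖c'‖ * ρ))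
    (hB : ∀ z ∈ closedBall z₀ ρ,
      h z ≠ 0 ∧ z ≠ (a : ℂ) - (ε : ℂ) * I ∧
        ‖(z - ((a : ℂ) - (ε : ℂ) * I))⁻¹ + deriv h z / h z - (c + c' * (z - ((a : ℂ) + (ε : ℂ) * I)))‖ ≤ Θ₂) :
    ∃ z₁ ∈ closedBall z₀ ρ, deriv g z₁ = 0 := by
  set u : ℂ := (a : ℂ) + (ε : ℂ) * I with hu
  set v : ℂ := (a : ℂ) - (ε : ℂ) * I with hv
  set w : ℂ := z₀ - u with hw
  set κ : ℂ := c + 2 * c' * w with hκ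
  have hd1 : Differentiable ℂ (deriv h) := by
    have := Literature.Analysis.Complex.differentiable_iteratedDeriv_of_entire hPF.1 1
    rwa [iteratedDeriv_one] at this
  -- the field, the linearised field, the comparison maps
  set b : ℂ → ℂ := fun z ↦ (z - v)⁻¹ + deriv h z / h z with hb
  set ℓ : ℂ → ℂ := fun z ↦ c + c' * (z - u) with hℓ
  set G : ℂ → ℂ := fun z ↦ 1 + (z - u) * b z with hG
  have hGd : DifferentiableOn ℂ G (closedBall z₀ ρ) := by
    intro z hz
    obtain ⟨hhz, hzv, -⟩ := hB z hz
    have hbd : DifferentiableAt ℂ (fun y : ℂ ↦ (y - v)⁻¹ + deriv h y / h y) z :=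
      ((differentiableAt_fun_id.sub_const v).inv (sub_ne_zero.mpr hzv)).add ((hd1 z).div (hPF.1 z) hhz)
    exact ((differentiableAt_const (1 : ℂ)).add ((differentiableAt_fun_id.sub_const u).mul hbd)).differentiableWithinAt
  have hz0c : z₀ ∈ closedBall z₀ ρ := mem_closedBall_self hρ.le
  have hΘ : 0 ≤ Θ₂ := le_trans (norm_nonneg _) (hB z₀ hz0c).2.2
  -- value at the centre: G z₀ = w · (b z₀ − ℓ z₀)
  have hGz₀ : G z₀ = w * (b z₀ - ℓ z₀) := by
    have : G z₀ = (1 + w * ℓ z₀) + w * (b z₀ - ℓ z₀) := by simp only [hG, hw]; ring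
    rw [this]
    have h0 : 1 + w * ℓ z₀ = 0 := by simp only [hw, hℓ]; exact hz0
    rw [h0, zero_add]
  have nG0 : ‖G z₀‖ ≤ ‖w‖ * Θ₂ := by
    rw [hGz₀, norm_mul]
    exact mul_le_mul_of_nonneg_left (hB z₀ hz0c).2.2 (norm_nonneg _)
  -- on the circle
  have he : ∀ z ∈ sphere z₀ ρ, ρ * (‖κ‖ - ‖c'‖ * ρ) - (2 * ‖w‖ + ρ) * Θ₂ ≤ ‖G z - G z₀‖ := by
    intro z hz
    have hzc : z ∈ closedBall z₀ ρ := sphere_subset_closedBall hz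
    have hρ' : ‖z - z₀‖ = ρ := by rw [← dist_eq_norm]; exact hz
    -- decomposition
    have e1 : G z - G z₀ = (z - z₀) * (κ + c' * (z - z₀)) + (z - u) * (b z - ℓ z) - w * (b z₀ - ℓ z₀) := by
      simp only [hG, hκ, hw, hℓ]; ring
    have n1 : ρ * (‖κ‖ - ‖c'‖ * ρ) ≤ ‖(z - z₀) * (κ + c' * (z - z₀))‖ := by
      rw [norm_mul, hρ']
      apply mul_le_mul_of_nonneg_left _ hρ.le
      have t1 : ‖κ‖ ≤ ‖κ + c' * (z - z₀)‖ + ‖c' * (z - z₀)‖ := by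
        have := norm_sub_le (κ + c' * (z - z₀)) (c' * (z - z₀))
        simpa using this
      have t2 : ‖c' * (z - z₀)‖ = ‖c'‖ * ρ := by rw [norm_mul, hρ']
      linarith
    have n2 : ‖(z - u) * (b z - ℓ z)‖ ≤ (‖w‖ + ρ) * Θ₂ := by
      rw [norm_mul]
      have t1 : ‖z - u‖ ≤ ‖w‖ + ρ := by
        have : z - u = w + (z - z₀) := by simp only [hw]; ring
        rw [this]
        have := norm_add_le w (z - z₀)
        linarith
      have t2 : ‖b z - ℓ z‖ ≤ Θ₂ := (hB z hzc).2.2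
      exact mul_le_mul t1 t2 (norm_nonneg _) (by positivity)
    have n3 : ‖w * (b z₀ - ℓ z₀)‖ ≤ ‖w‖ * Θ₂ := by
      rw [norm_mul]
      exact mul_le_mul_of_nonneg_left (hB z₀ hz0c).2.2 (norm_nonneg _)
    have n4 : ‖(z - z₀) * (κ + c' * (z - z₀))‖ ≤ ‖G z - G z₀‖ + ‖(z - u) * (b z - ℓ z)‖ + ‖w * (b z₀ - ℓ z₀)‖ := by
      have hsplit : (z - z₀) * (κ + c' * (z - z₀)) = (G z - G z₀) - (z - u) * (b z - ℓ z) + w * (b z₀ - ℓ z₀) := by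
        rw [e1]; ring
      rw [hsplit]
      have a1 := norm_add_le ((G z - G z₀) - (z - u) * (b z - ℓ z)) (w * (b z₀ - ℓ z₀))
      have a2 := norm_sub_le (G z - G z₀) ((z - u) * (b z - ℓ z))
      linarith
    linarith
  have h0 : ‖G z₀‖ < (ρ * (‖κ‖ - ‖c'‖ * ρ) - (2 * ‖w‖ + ρ) * Θ₂) / 2 := by
    have : (4 * ‖w‖ + ρ) * Θ₂ < ρ * (‖κ‖ - ‖c'‖ * ρ) := by simpa [hκ, hw] using hnum
    linarith
  obtain ⟨z₁, hz₁, hGz₁⟩ := exists_zero_of_sphere_bound hGd hρ he h0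
  refine ⟨z₁, hz₁, ?_⟩
  obtain ⟨hh1, hv1, -⟩ := hB z₁ hz₁
  have key := deriv_pair_eq_G hPF hh1 hv1
  rw [key, ← hv, ← hu]
  have hG1 : 1 + (z₁ - u) * ((z₁ - v)⁻¹ + deriv h z₁ / h z₁) = 0 := hGz₁
  rw [hG1, mul_zero]

/-- (K) sanity: the frozen law is the case `c' = 0` — `z₀ = u − 1/c` solves the linearised equation and `κ = c`. -/
theorem linearised_root_frozen {u c : ℂ} (hc : c ≠ 0) : 1 + ((u - 1 / c) - u) * (c + 0 * ((u - 1 / c) - u)) = 0 := by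
  field_simp
  ring

/-- **LINEARISED-G predicate** (the second-order seam slot): pair factorisation at `u`, field data `c, c'`, a root `z₀` of the linearised map,
remainder `Θ₂` on `D̄(z₀, ρ)`, the numeric inequality, and the disc placed inside the column window: `Im z₀ − ρ > 0`, `Im z₀ + ρ ≤ Im u − d`,
`|Re z₀ − Re u| + ρ ≤ σ`. -/
def LinearisedGAt (d σ : ℝ) (g : ℂ → ℂ) (u : ℂ) : Prop :=
  ∃ (h : ℂ → ℂ) (c c' z₀ : ℂ) (Θ₂ ρ : ℝ), PairFactor g h u.re u.im ∧ 0 < ρ ∧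
    1 + (z₀ - (((u.re : ℝ) : ℂ) + ((u.im : ℝ) : ℂ) * I)) * (c + c' * (z₀ - (((u.re : ℝ) : ℂ) + ((u.im : ℝ) : ℂ) * I))) = 0 ∧
    (4 * ‖z₀ - (((u.re : ℝ) : ℂ) + ((u.im : ℝ) : ℂ) * I)‖ + ρ) * Θ₂
      < ρ * (‖c + 2 * c' * (z₀ - (((u.re : ℝ) : ℂ) + ((u.im : ℝ) : ℂ) * I))‖ - ‖c'‖ * ρ) ∧
    0 < z₀.im - ρ ∧ z₀.im + ρ ≤ u.im - d ∧ |z₀.re - u.re| + ρ ≤ σ ∧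
    ∀ z ∈ closedBall z₀ ρ, h z ≠ 0 ∧ z ≠ ((u.re : ℝ) : ℂ) - ((u.im : ℝ) : ℂ) * I ∧
      ‖(z - (((u.re : ℝ) : ℂ) - ((u.im : ℝ) : ℂ) * I))⁻¹ + deriv h z / h z
        - (c + c' * (z - (((u.re : ℝ) : ℂ) + ((u.im : ℝ) : ℂ) * I)))‖ ≤ Θ₂

/-- ★ exit: the linearised certificate puts a zero of `g′` in the column window. -/
theorem linearisedGAt_exit {d σ : ℝ} {g : ℂ → ℂ} {u : ℂ} (hL : LinearisedGAt d σ g u) : SuccColAt d σ g u := by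
  obtain ⟨h, c, c', z₀, Θ₂, ρ, hPF, hρ, hz0, hnum, hlo, hhi, hre, hB⟩ := hL
  obtain ⟨z₁, hz₁, hd⟩ := successor_of_linearisedField hPF hρ hz0 hnum hB
  have hn : ‖z₁ - z₀‖ ≤ ρ := by rw [← dist_eq_norm]; exact hz₁
  have him : |(z₁ - z₀).im| ≤ ρ := le_trans (abs_im_le_norm _) hn
  have hre' : |(z₁ - z₀).re| ≤ ρ := le_trans (abs_re_le_norm _) hn
  rw [sub_im] at him
  rw [sub_re] at hre'
  obtain ⟨him1, him2⟩ := abs_le.mp him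
  refine ⟨z₁, hd, by linarith, ?_, by linarith⟩
  have : |z₁.re - u.re| ≤ |z₁.re - z₀.re| + |z₀.re - u.re| := by
    have := abs_add_le (z₁.re - z₀.re) (z₀.re - u.re)
    simpa using this
  linarith

end RhW07.Law421.SuccessorCertificate

end
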